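import Mathlib
import HarnessLib
import Summits.Parity.Statement
import Summits.Parity.GeneralizedHardyLittlewood.Theses.SiegelBandSplit

/-!
# Assembly of route-Parity-SiegelBandSplit (item stmt-Parity-26321)

`Assembly : HighBandZeroFree → LowBandZeroFree → UpperGivenBoundedSiegel → LowerGivenBoundedSiegel → GeneralizedHardyLittlewood` is literally the route's certified deciding theorem `closes`
(node G1.1 «SiegelBandSplit» (standalone rendering, decomp-parity lens-2 g2; rev 0)): the two Siegel bands re-assemble Q (`boundedQuality_iff_bands`), then as in the record route.  One line; no mathematics beyond the route file.
-/

namespace Summit.Parity.GeneralizedHardyLittlewood.Theses.SiegelBandSplit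

/-- Assembly item stmt-Parity-26321 of route-Parity-SiegelBandSplit:
`HighBandZeroFree → LowBandZeroFree → UpperGivenBoundedSiegel → LowerGivenBoundedSiegel → GeneralizedHardyLittlewood`,
by the route's deciding theorem `closes`. -/
theorem assembly_proof : Assembly :=
  fun h1 h2 h3 h4 => closes h1 h2 h3 h4

end Summit.Parity.GeneralizedHardyLittlewood.Theses.SiegelBandSplit
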